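import Summits.ResolutionOfSingularities.ResolutionOfSingularities.Theorems.MarkedTransferCampaignW46HostSurfaces
import Literature.AlgebraicGeometry.Resolution.DivisorialPart
import Literature.AlgebraicGeometry.Resolution.NearPointColengthDropScheme
import Literature.AlgebraicGeometry.Resolution.ColengthOffCentre
import Literature.AlgebraicGeometry.Resolution.RegularCentreBlowupOrder
import Literature.AlgebraicGeometry.Resolution.BlowupExceptionalGenericOrder
import Literature.AlgebraicGeometry.Resolution.GermsOfClosedSubsets
import Literature.AlgebraicGeometry.Resolution.KollarBoundarySeparationTameSurface
import Literature.AlgebraicGeometry.Resolution.CurveBlowupDeltaDrop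
import Literature.AlgebraicGeometry.Resolution.MarkedIdealsArithmetic
import HarnessLib

/-!
# [OURS · L1 W4.6 rung (i) SURFACES, host words] Blowing up a BASE POINT of the codimension-two part of a marked ideal on a
# regular surface: the decomposition `I = H · J` persists and the pair `(ord_x J, λ(𝒪_x/J_x))` drops lexicographically

Cell res-hironaka, LADDER-RESOLUTION rung L (D-0089), slot W4.6 «restricted regimes as rungs», rung (i) SURFACES; seat res-L1-s46-pv-1
(gen 7). The one-blow-up analysis behind `…W46MarkedSurfaces.lean` (marked order reduction for EVERY ideal sheaf on a regular
surface): a non-zero ideal sheaf `I` on a regular surface factors as `I = H · J` with `H` invertible and `V(J)` a finite set of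
closed points (its non-locally-principal locus; Cossart–Piltant 2008, proof of Prop. 4.2, tree `DivisorialPart.lean`). Blowing up a
point `x ∈ V(J)` with `a = ord_x H`, `r = ord_x J ≥ 1` and `m ≤ a + r = ord_x I`:

* `controlledTransform_mul_eq_of_le` — `τᶜ(I, m) = (𝓘_exc^{a+r−m} · τᶜ(H, a)) · τᶜ(J, r)`, the first factor effective Cartier
  (BGMW Lemma 3.7.1 multiplicativity of controlled transforms + cancellation of the exceptional factor);
* `one_lt_coheight_of_mem_support_controlledTransform` — `V(τᶜ(J, r))` has again codimension `≥ 2` (off the exceptional curve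
  nothing changes; along it the generic order of `J𝒪_{X′}` is `r`, Stacks 0804, so the weak transform does not vanish generically);
* `toLex_lt_of_over` — at a point `y` over `x` in `V(τᶜ(J, r))`: `(ord_y J′, λ(𝒪_y/J′_y)) <_lex (ord_x J, λ(𝒪_x/J_x))` — the order of
  the weak transform does not go up (Cossart–Piltant 2008 Prop. 4.2 (a)), and where it stays (`y` NEAR) the colength drops (Zariski
  / Huneke–Swanson Lemma 14.3.4, tree `IsBlowup.length_quotient_stalkIdeal_controlledTransform_lt_of_isNear`);
* `…_of_ne` lemmas — off `x` the blow-up is an isomorphism: orders, colengths, codimensions and the points themselves correspond.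

Proposed `--kind proof --supports` stmt-ResolutionOfSingularities-16156 `--as helper`. Everything is OURS bookkeeping over the
tree's blow-up calculus; nothing of H. Hironaka's manuscript [Hironaka2017] is asserted. AI-written; AI review is weaker than expert
review.

## Sources

* V. Cossart, O. Piltant, J. Algebra 320 (2008), proof of Prop. 4.2 (divisorial part; near points (a)) and of Prop. 4.4
  (termination above curves of `Σ`). [CossartPiltant2008]
* C. Huneke, I. Swanson, *Integral Closure of Ideals, Rings, and Modules* (2006), Lemma 14.3.4. [HunekeSwanson2006]
* O. Zariski, P. Samuel, *Commutative Algebra* II (1960), Appendix 5. [ZariskiSamuel1960]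
* E. Bierstone, D. Grigoriev, P. Milman, J. Włodarczyk, arXiv:1206.3090, Lemma 3.7.1. [BierstoneGrigorievMilmanWlodarczyk2011]
* H. Hironaka, ms. 2017-03-23 — scope only, under adjudication, not cited as fact. [Hironaka2017]
-/

noncomputable section

set_option linter.dupNamespace false -- mandated namespace of this single-conjunct summit

open CategoryTheory AlgebraicGeometry TopologicalSpace IsLocalRing

namespace Summit.ResolutionOfSingularities.ResolutionOfSingularities.Theorems

namespace CampaignW46

open Literature.AlgebraicGeometry.Resolution
open Scheme.IdealSheafData

universe u

variable {X : Scheme.{u}}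

/-! ## §1 Points of codimension two on a surface -/

/-- On a scheme of dimension `≤ 2`, a point of codimension `> 1` has codimension `2`, a two-dimensional local ring, and is closed.
[cite: StacksProject, Tag 02IZ] -/
theorem coheight_eq_two_of_one_lt (hd : topologicalKrullDim X ≤ 2) {x : X} (hx : 1 < Order.coheight x) :
    Order.coheight x = 2 ∧ ringKrullDim (X.presheaf.stalk x) = 2 ∧ IsClosed ({x} : Set X) := by
  have h2 : ((Order.height x + Order.coheight x : ℕ∞) : WithBot ℕ∞) ≤ 2 :=
    (coe_height_add_coheight_le_topologicalKrullDim x).trans hd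
  have h3 : Order.height x + Order.coheight x ≤ 2 := WithBot.coe_le_coe.mp h2
  have hc : Order.coheight x ≤ 2 := le_add_self.trans h3
  have hcoh : Order.coheight x = 2 := by
    have hne : Order.coheight x ≠ ⊤ := ne_top_of_le_ne_top (by decide) hc
    obtain ⟨c, hc'⟩ := ENat.ne_top_iff_exists.mp hne
    rw [← hc'] at hx hc ⊢
    have h1 : 1 < c := by exact_mod_cast hx
    have h2 : c ≤ 2 := by exact_mod_cast hc
    exact_mod_cast (show c = 2 by omega)
  have hR : ringKrullDim (X.presheaf.stalk x) = 2 := by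
    rw [ringKrullDim_stalk_eq_coheight, hcoh]; rfl
  exact ⟨hcoh, hR, isClosed_singleton_of_two_le_ringKrullDim_stalk hd hR.ge⟩

/-- **On a Noetherian scheme of dimension `≤ 2`, a closed set of points of codimension `> 1` is a finite set of closed points with
two-dimensional local rings** (in particular the non-locally-principal locus `V(J)` of an ideal sheaf on a regular surface,
Cossart–Piltant 2008, proof of Prop. 4.2: "`V(J)` has codimension at least two"). [cite: CossartPiltant2008, proof of Prop. 4.2] -/
theorem finite_support_of_one_lt_coheight [IsNoetherian X] (hd : topologicalKrullDim X ≤ 2) {J : X.IdealSheafData}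
    (hJ : ∀ x ∈ J.support, 1 < Order.coheight x) : (J.support : Set X).Finite := by
  have hcl : ∀ x ∈ (J.support : Set X), IsClosed ({x} : Set X) := fun x hx => (coheight_eq_two_of_one_lt hd (hJ x hx)).2.2
  -- a closed set of closed points of a Noetherian sober space is finite
  obtain ⟨S, hSf, hSc, hSi, hSU⟩ := NoetherianSpace.exists_finite_set_isClosed_irreducible J.support.isClosed
  rw [hSU]
  refine hSf.sUnion fun t ht => ?_
  obtain ⟨y, hy⟩ := QuasiSober.sober (hSi t ht) (hSc t ht)
  have hyt : y ∈ t := hy.mem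
  have hys : ({y} : Set X) = t := by
    rw [← hy.def, (hcl y (hSU ▸ Set.subset_sUnion_of_mem ht hyt)).closure_eq]
  rw [← hys]
  exact Set.finite_singleton y

/-- A closed point `x ∈ V(J)` all of whose fellow points of `V(J)` are closed is a maximal point of `V(J)`. [folklore] -/
theorem mem_maxPoints_support_of_forall_isClosed {J : X.IdealSheafData} (hcl : ∀ x ∈ (J.support : Set X), IsClosed ({x} : Set X))
    {x : X} (hx : x ∈ (J.support : Set X)) : x ∈ maxPoints (J.support : Set X) := by
  refine mem_maxPoints_iff.mpr ⟨hx, fun η hη hηx => ?_⟩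
  have : x ∈ closure ({η} : Set X) := hηx.mem_closure
  rw [(hcl η hη).closure_eq, Set.mem_singleton_iff] at this
  exact this.symm


/-! ## §2 The decomposition `I = H · J` along the blow-up of a point -/

section Step

variable [IsIntegral X] [IsLocallyNoetherian X] (hX : Scheme.IsRegular X) {x : X} (hx : IsClosed ({x} : Set X))
  (hxne : ({x} : Set X) ≠ Set.univ) {X' : Scheme.{u}} {π : X' ⟶ X} (hπ : IsBlowup π (vanishingIdeal ⟨{x}, hx⟩))

omit [IsIntegral X] in
include hπ in
/-- **Lowering the control multiplies by the exceptional divisor**: for `K ⊆ 𝓘_{x}^n` and `m ≤ n`,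
`τᶜ(K, m) = 𝓘_exc^{n−m} · τᶜ(K, n)` (`𝓘_exc^n · τᶜ(K, n) = K𝒪_{X′}` and cancellation of the invertible `𝓘_exc^m`).
[cite: BierstoneGrigorievMilmanWlodarczyk2011, Lemma 3.2.1] -/
theorem controlledTransform_eq_pow_mul_of_le {K : X.IdealSheafData} {n m : ℕ} (hmn : m ≤ n)
    (hK : K ≤ vanishingIdeal ⟨{x}, hx⟩ ^ n) :
    controlledTransform π (vanishingIdeal ⟨{x}, hx⟩) K m =
      (vanishingIdeal ⟨{x}, hx⟩).comap π ^ (n - m) * controlledTransform π (vanishingIdeal ⟨{x}, hx⟩) K n := by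
  haveI : IsLocallyNoetherian X' := hπ.isLocallyNoetherian
  have hE : IsEffectiveCartier ((vanishingIdeal ⟨{x}, hx⟩).comap π) := hπ.isEffectiveCartier
  have hKn : (vanishingIdeal ⟨{x}, hx⟩).comap π ^ n * controlledTransform π (vanishingIdeal ⟨{x}, hx⟩) K n = K.comap π :=
    hπ.pow_mul_controlledTransform_eq (comap_le_comap_pow_of_le_pow hK π)
  obtain ⟨d, rfl⟩ : ∃ d, n = m + d := ⟨n - m, by omega⟩
  rw [show m + d - m = d by omega]
  show colon (K.comap π) ((vanishingIdeal ⟨{x}, hx⟩).comap π ^ m) = _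
  rw [← hKn, pow_add, mul_assoc]
  exact colon_pow_mul_eq hE _ m

omit [IsIntegral X] in
include hπ in
/-- **`τᶜ(H · J, m) = (𝓘_exc^{a+r−m} · τᶜ(H, a)) · τᶜ(J, r)`** for `H ⊆ 𝓘_{x}^a`, `J ⊆ 𝓘_{x}^r` and `m ≤ a + r`: multiplicativity of
controlled transforms (BGMW Lemma 3.7.1 (2), tree `controlledTransform_mul`) after `controlledTransform_eq_pow_mul_of_le`.
[cite: BierstoneGrigorievMilmanWlodarczyk2011, Lemma 3.7.1 (2)] -/
theorem controlledTransform_mul_eq_of_le {H J : X.IdealSheafData} {a r m : ℕ} (hHa : H ≤ vanishingIdeal ⟨{x}, hx⟩ ^ a)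
    (hJr : J ≤ vanishingIdeal ⟨{x}, hx⟩ ^ r) (hm : m ≤ a + r) :
    controlledTransform π (vanishingIdeal ⟨{x}, hx⟩) (H * J) m =
      ((vanishingIdeal ⟨{x}, hx⟩).comap π ^ (a + r - m) * controlledTransform π (vanishingIdeal ⟨{x}, hx⟩) H a) *
        controlledTransform π (vanishingIdeal ⟨{x}, hx⟩) J r := by
  haveI : IsLocallyNoetherian X' := hπ.isLocallyNoetherian
  have hE : IsEffectiveCartier ((vanishingIdeal ⟨{x}, hx⟩).comap π) := hπ.isEffectiveCartier
  have hHJ : H * J ≤ vanishingIdeal ⟨{x}, hx⟩ ^ (a + r) := by rw [pow_add]; exact mul_le_mul' hHa hJr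
  rw [controlledTransform_eq_pow_mul_of_le hx hπ hm hHJ,
    controlledTransform_mul hE (comap_le_comap_pow_of_le_pow hHa π) (comap_le_comap_pow_of_le_pow hJr π), mul_assoc]

include hX hxne hπ in
/-- The new divisorial factor `𝓘_exc^{e} · τᶜ(H, a)` is effective Cartier (`H` effective Cartier `≠ 0`, `a ≤ ord_x H`).
[cite: Kollar2007, 3.60] -/
theorem isEffectiveCartier_pow_mul_controlledTransform {H : X.IdealSheafData} (hH0 : H ≠ ⊥) (hH : IsEffectiveCartier H)
    {a : ℕ} (ha : (a : ℕ∞) ≤ idealOrder H x) (e : ℕ) :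
    IsEffectiveCartier ((vanishingIdeal ⟨{x}, hx⟩).comap π ^ e * controlledTransform π (vanishingIdeal ⟨{x}, hx⟩) H a) :=
  (hπ.isEffectiveCartier.pow e).mul (controlledTransform_ne_bot_and_isEffectiveCartier_point hX hx hxne hπ hH0 hH ha).2

/-! ## §3 Off the centre nothing changes -/

omit [IsIntegral X] [IsLocallyNoetherian X] in
/-- The exceptional locus is `π⁻¹(x)`: `π y ∉ V(𝓘_{x}) ↔ π y ≠ x`. [folklore] -/
theorem not_mem_support_vanishingIdeal_iff {y : X'} : π y ∉ (vanishingIdeal ⟨{x}, hx⟩).support ↔ π y ≠ x := by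
  rw [← SetLike.mem_coe, Scheme.IdealSheafData.coe_support_vanishingIdeal, Closeds.coe_mk, Set.mem_singleton_iff]

omit [IsIntegral X] [IsLocallyNoetherian X] in
include hπ in
/-- **Off `x` the weak transform has the same order, colength and support, and the point the same codimension** (the blow-up is a
local isomorphism there). [cite: CossartPiltant2008, proof of Prop. 4.4] -/
theorem offCentre_eq [IsLocallyNoetherian X'] (K : X.IdealSheafData) (μ : ℕ) {y : X'} (hyx : π y ≠ x) :
    idealOrder (controlledTransform π (vanishingIdeal ⟨{x}, hx⟩) K μ) y = idealOrder K (π y) ∧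
      Module.length (X'.presheaf.stalk y)
          (X'.presheaf.stalk y ⧸ stalkIdeal (controlledTransform π (vanishingIdeal ⟨{x}, hx⟩) K μ) y) =
        Module.length (X.presheaf.stalk (π y)) (X.presheaf.stalk (π y) ⧸ stalkIdeal K (π y)) ∧
      (y ∈ (controlledTransform π (vanishingIdeal ⟨{x}, hx⟩) K μ).support ↔ π y ∈ K.support) ∧
      Order.coheight y = Order.coheight (π y) := by
  have hxC : π y ∉ (vanishingIdeal ⟨{x}, hx⟩).support := (not_mem_support_vanishingIdeal_iff hx).mpr hyx
  have h1 := hπ.idealOrder_controlledTransform_eq_of_not_mem_support K μ hxC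
  refine ⟨h1, hπ.length_quotient_stalkIdeal_controlledTransform_eq_of_not_mem_support K μ hxC, ?_, ?_⟩
  · rw [← one_le_idealOrder_iff, ← one_le_idealOrder_iff, h1]
  · haveI := hπ.isIso_stalkMap_of_not_mem_support hxC
    have h := ringKrullDim_eq_of_ringEquiv (asIso (π.stalkMap y)).commRingCatIsoToRingEquiv
    rw [ringKrullDim_stalk_eq_coheight, ringKrullDim_stalk_eq_coheight] at h
    exact_mod_cast h.symm

omit [IsIntegral X] [IsLocallyNoetherian X] in
include hπ in
/-- Off `x` every point has exactly one preimage. [cite: StacksProject, Tag 02OS] -/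
theorem existsUnique_preimage {z : X} (hz : z ≠ x) : ∃! y : X', π y = z :=
  hπ.existsUnique_preimage_of_ne (Scheme.IdealSheafData.coe_support_vanishingIdeal _) hz

/-! ## §4 The codimension-two part stays of codimension two -/

omit [IsLocallyNoetherian X] in
include hX hxne hπ in
/-- **`V(τᶜ(J, ord_x J))` has codimension `≥ 2` if `V(J)` has**: off `x` by §3; over `x` the weak transform of `J` has order
`ord_x J − ord_x J = 0` at the maximal points of the exceptional locus (Stacks 0804, tree
`IsBlowup.idealOrder_controlledTransform_of_mem_maxPoints`), so a point of its support over `x` specialises strictly from a maximal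
point of `π⁻¹(x)`, which itself has positive codimension. [cite: CossartPiltant2008, proof of Prop. 4.2] -/
theorem one_lt_coheight_of_mem_support_controlledTransform [IsLocallyNoetherian X'] {J : X.IdealSheafData}
    (hJ : ∀ z ∈ J.support, 1 < Order.coheight z) {r : ℕ} (hr : idealOrder J x = r) {y : X'}
    (hy : y ∈ (controlledTransform π (vanishingIdeal ⟨{x}, hx⟩) J r).support) : 1 < Order.coheight y := by
  set P := vanishingIdeal ⟨{x}, hx⟩ with hP
  by_cases hyx : π y = x
  · -- over `x`
    have hP0 : P ≠ ⊥ := vanishingIdeal_singleton_ne_bot hx hxne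
    haveI : IsIntegral X' := hπ.isIntegral hP0
    have hZ : IsClosed (π ⁻¹' ({x} : Set X)) := hx.preimage π.continuous
    have hyZ : y ∈ π ⁻¹' ({x} : Set X) := hyx
    obtain ⟨η, hη, hηy⟩ := exists_mem_maxPoints_specializes hZ hyZ
    by_cases hηeq : η = y
    · -- `y` would be a maximal point of the exceptional locus, where the weak transform has order `0`
      subst hηeq
      haveI := hX (π η)
      have hη' : η ∈ maxPoints (π ⁻¹' ((⟨{x}, hx⟩ : Closeds X) : Set X)) := hη
      have hηx : stalkIdeal P (π η) = maximalIdeal (X.presheaf.stalk (π η)) := by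
        rw [hyx]
        exact stalkIdeal_vanishingIdeal_eq_maximalIdeal_of_closure_eq (by rw [hx.closure_eq]; rfl)
      have h0 := hπ.idealOrder_controlledTransform_of_mem_maxPoints hη' hηx J r
      rw [hyx, hr, tsub_self (r : ℕ∞)] at h0
      have h1 : (1 : ℕ∞) ≤ idealOrder (controlledTransform π P J r) η := (one_le_idealOrder_iff _ η).mpr hy
      rw [h0] at h1
      exact absurd h1 (by decide)
    · -- `y` specialises strictly from a maximal point `η` of `π⁻¹(x)`, and `η` is not the generic point of `X′`
      have hlt : y < η := lt_of_le_not_ge (Scheme.le_iff_specializes.mpr hηy) fun h' =>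
        hηeq (Specializes.antisymm hηy (Scheme.le_iff_specializes.mp h')).eq
      have h1 : Order.coheight η + 1 ≤ Order.coheight y := Order.coheight_add_one_le hlt
      have hηE : η ∈ (P.comap π).support := by
        rw [Scheme.IdealSheafData.support_comap]
        change π η ∈ (P.support : Set X)
        rw [hP, Scheme.IdealSheafData.coe_support_vanishingIdeal]
        exact hη.1
      have hη0 : Order.coheight η ≠ 0 := by
        intro h0
        rw [eq_genericPoint_of_coheight_eq_zero h0] at hηE
        refine not_mem_support_genericPoint (hπ.comap_ne_bot ?_ hP0) hηE
        intro htop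
        apply hxne
        have := congrArg (fun Z : Closeds X => (Z : Set X)) htop
        simpa [hP, Scheme.IdealSheafData.coe_support_vanishingIdeal] using this
      have h2 : (1 : ℕ∞) ≤ Order.coheight η := Order.one_le_iff_ne_zero.mpr hη0
      calc (1 : ℕ∞) < 1 + 1 := by decide
        _ ≤ Order.coheight η + 1 := by gcongr
        _ ≤ Order.coheight y := h1
  · -- off `x`
    obtain ⟨-, -, hmem, hcoh⟩ := offCentre_eq hx hπ J r hyx
    rw [hcoh]
    exact hJ (π y) (hmem.mp hy)

/-! ## §5 Over `x` the pair `(ord, colength)` of the codimension-two part drops -/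

omit [IsIntegral X] in
include hX hπ in
/-- **At a point `y` over the base point `x` the pair `(ord_y J′, λ(𝒪_y/J′_y))` is lexicographically smaller than
`(ord_x J, λ(𝒪_x/J_x))`**, `J′ = τᶜ(J, ord_x J)` the weak transform: the order does not go up (Cossart–Piltant 2008, Prop. 4.2
(a), tree `IsBlowup.idealOrder_controlledTransform_le_of_mem`), and if it stays (`y` near) the colength drops (Huneke–Swanson
Lemma 14.3.4, tree `IsBlowup.length_quotient_stalkIdeal_controlledTransform_lt_of_isNear`; `x` is a closed point of `V(J)` with
two-dimensional regular local ring and `J_x` is `𝔪_x`-primary). [cite: CossartPiltant2008, proof of Prop. 4.2 (a) and Prop. 4.4]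
[cite: HunekeSwanson2006, Lemma 14.3.4] -/
theorem toLex_lt_of_over [IsLocallyNoetherian X'] {J : X.IdealSheafData}
    (hJcl : ∀ z ∈ (J.support : Set X), IsClosed ({z} : Set X)) (hxJ : x ∈ (J.support : Set X))
    (hcoh : Order.coheight x = 2) {r : ℕ} (hr : idealOrder J x = r) {y : X'} (hyx : π y = x) :
    toLex (idealOrder (controlledTransform π (vanishingIdeal ⟨{x}, hx⟩) J r) y,
        Module.length (X'.presheaf.stalk y)
          (X'.presheaf.stalk y ⧸ stalkIdeal (controlledTransform π (vanishingIdeal ⟨{x}, hx⟩) J r) y)) <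
      toLex (idealOrder J x, Module.length (X.presheaf.stalk x) (X.presheaf.stalk x ⧸ stalkIdeal J x)) := by
  subst hyx
  set P := vanishingIdeal ⟨{π y}, hx⟩ with hP
  haveI := hX (π y)
  have hPreg : Scheme.IsRegular P.subscheme := isRegular_subscheme_vanishingIdeal_singleton hx
  have hY : ∀ z ∈ ((⟨{π y}, hx⟩ : Closeds X) : Set X), idealOrder J z = r := fun z hz => by
    rw [show z = π y from hz]; exact hr
  have hmem : π y ∈ ((⟨{π y}, hx⟩ : Closeds X) : Set X) := rfl
  have hle : idealOrder (controlledTransform π P J r) y ≤ r := hπ.idealOrder_controlledTransform_le_of_mem hX hPreg hY hmem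
  rw [Prod.Lex.toLex_lt_toLex, hr]
  rcases hle.lt_or_eq with hlt | heq
  · exact Or.inl hlt
  · refine Or.inr ⟨heq, ?_⟩
    have hr1 : 1 ≤ r := by
      have h1 : (1 : ℕ∞) ≤ idealOrder J (π y) := (one_le_idealOrder_iff J (π y)).mpr hxJ
      rw [hr] at h1
      exact_mod_cast h1
    exact hπ.length_quotient_stalkIdeal_controlledTransform_lt_of_isNear hr1 hY
      (stalkIdeal_vanishingIdeal_eq_maximalIdeal_of_closure_eq (by rw [hx.closure_eq]; rfl))
      (spanFinrank_maximalIdeal_stalk_eq (π y) hcoh)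
      (isFiniteLength_quotient_stalkIdeal_of_mem_maxPoints (mem_maxPoints_support_of_forall_isClosed hJcl hxJ)) heq

end Step

end CampaignW46

end Summit.ResolutionOfSingularities.ResolutionOfSingularities.Theorems

end
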